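import Summits.KontsevichZagierPeriods.KontsevichZagierPeriods.Theses.HurwitzMicroSectors
import Literature.NumberTheory.Transcendental.KZLogCalculusProofs
import Summits.KontsevichZagierPeriods.KontsevichZagierPeriods.Theorems.HurwitzMicroSectorsHurwitzSectorComplementStubNfValue
import Summits.KontsevichZagierPeriods.KontsevichZagierPeriods.Theorems.HurwitzMicroSectorsHurwitzSectorComplementStubConstAcrossDim
import Summits.KontsevichZagierPeriods.KontsevichZagierPeriods.Theorems.HurwitzMicroSectorsHurwitzSectorComplementStubRigidityNumbers
import Summits.KontsevichZagierPeriods.KontsevichZagierPeriods.Theorems.HurwitzMicroSectorsHurwitzSectorComplementStubPairValueAlgebraic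
import Summits.KontsevichZagierPeriods.KontsevichZagierPeriods.Theorems.HurwitzMicroSectorsHurwitzSectorComplementStubOkada
import Summits.KontsevichZagierPeriods.KontsevichZagierPeriods.Theorems.HurwitzMicroSectorsHurwitzSectorComplementStubSymReduction

/-!
# Conjecture 1 of Kontsevich–Zagier on the symmetric (Bernoulli-parity) Hurwitz tower — PROVED

Crux `HurwitzSectorComplement` (stmt-KontsevichZagierPeriods-14341, route HurwitzMicroSectors), line
`galois-parity-half`, composition of the six landed stubs S1–S6 (this file adds no mathematics of its own):
for ALL weights `w ≥ 2` and levels `N ≥ 1`, any two integral representations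
`[(0,1)^w, Q(t) + R(t)/(1 − t^N)]` (`t = x₁⋯x_w`, `Q, R ∈ ℚ[t]`, `deg R < N`, `R` `(−1)^w`-symmetric:
`R_i = (−1)^w R_{N−2−i}`, and `R_{N−1} = 0` when `w` is odd) — the half of every Hurwitz rung
`(w, N)` whose values lie in `ℚ + ℚ̄·π^w` — with equal values are KZ-equivalent; across different
weights and levels too. Inputs: dilations `xᵢ ↦ xᵢ^g` (= distribution relations) + Kubert generation
over `ℚ` (S1), the value computation (S2), Bernoulli–Fourier evaluation (S3), OKADA'S THEOREM 1981
(S4, proved in the tree: cyclotomic Galois twisting + Dirichlet characters + `L(χ,w) ≠ 0`),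
coefficient comparison by Lindemann (S5), constants across dimensions (S6). The off-tower remainder of
the crux is the declared summit-strength stub S7 (`NormalFormPrinciple` ≡ the summit) and is NOT claimed.
[cite: KontsevichZagier2001, §1.2 Conjecture 1] [cite: Okada1981, Theorem] [cite: GunMurtyRath2011, Thm 1]
-/

noncomputable section

open Set MeasureTheory
open scoped BigOperators
open Literature.NumberTheory.Transcendental

namespace Summit.KontsevichZagierPeriods.Theorems.HurwitzMicroSectorsHurwitzSectorComplement

open Summit.KontsevichZagierPeriods.KontsevichZagierPeriods.Theses.HurwitzMicroSectors

/-! ## Composition: S1–S6 ⇒ the symmetric tower sector -/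

/-- **Conjecture 1 on the whole symmetric Hurwitz tower** (all weights `w ≥ 2`, all levels `N ≥ 1`,
across weights and levels), from the stubs S1–S6: lift both representations to the common level
`L = 3NN'`, reduce to normal forms (S1), read the values (S2, soundness), compare (S5 fed by S3, S4):
equal weight ⇒ identical normal forms ⇒ one congruence move; different weights ⇒ both normal forms are
the same constant ⇒ S6. [cite: GunMurtyRath2011, Thm 1] [cite: KontsevichZagier2001, §1.2] -/
theorem symmetricTowerSector : ∀ (w N w' N' : ℕ), 2 ≤ w → 1 ≤ N → 2 ≤ w' → 1 ≤ N' → ∀ (r : KZ.IntegralRep w) (r' : KZ.IntegralRep w'), (∃ (Q R : Polynomial ℚ), R.natDegree < N ∧ (∀ i j : ℕ, i + j + 2 = N → R.coeff i = (-1 : ℚ) ^ w * R.coeff j) ∧ (Odd w → R.coeff (N - 1) = 0) ∧ r.domain = {x | ∀ i, x i ∈ Set.Ioo (0:ℝ) 1} ∧ Set.EqOn r.integrand (fun x => Polynomial.aeval (∏ i, x i) Q + Polynomial.aeval (∏ i, x i) R / (1 - (∏ i, x i) ^ N)) r.domain) → (∃ (Q R : Polynomial ℚ), R.natDegree < N'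 ∧ (∀ i j : ℕ, i + j + 2 = N' → R.coeff i = (-1 : ℚ) ^ w' * R.coeff j) ∧ (Odd w' → R.coeff (N' - 1) = 0) ∧ r'.domain = {x | ∀ i, x i ∈ Set.Ioo (0:ℝ) 1} ∧ Set.EqOn r'.integrand (fun x => Polynomial.aeval (∏ i, x i) Q + Polynomial.aeval (∏ i, x i) R / (1 - (∏ i, x i) ^ N')) r'.domain) → r.value = r'.value → KZ.Equivalent r r' := by
  intro w N w' N' hw hN hw' hN' r r' ⟨Q, R, hR, hsym, hodd, hd, hf⟩ ⟨Q', R', hR', hsym', hodd', hd', hf'⟩ hv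
  -- a common level `L = 3·N·N' ≥ 3`
  obtain ⟨L, hL⟩ : ∃ L : ℕ, L = 3 * (N * N') := ⟨_, rfl⟩
  have hL3 : 3 ≤ L := by
    have h1 : 1 ≤ N * N' := Nat.one_le_iff_ne_zero.mpr (Nat.mul_ne_zero (by omega) (by omega))
    rw [hL]
    calc 3 = 3 * 1 := by norm_num
      _ ≤ 3 * (N * N') := Nat.mul_le_mul_left 3 h1
  have hNL : N ∣ L := ⟨3 * N', by rw [hL]; ring⟩
  have hN'L : N' ∣ L := ⟨3 * N, by rw [hL]; ring⟩
  -- S1: normal forms at level `L`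
  obtain ⟨c, μ, n, hnd, hnf, hrn⟩ := stub_symReduction w N L hw hN hL3 hNL r Q R hR hsym hodd hd hf
  obtain ⟨c', μ', n', hnd', hnf', hrn'⟩ :=
    stub_symReduction w' N' L hw' hN' hL3 hN'L r' Q' R' hR' hsym' hodd' hd' hf'
  -- S2 + soundness: the values
  have hvn := stub_nfValue w L c μ n hw hL3 hnd hnf
  have hvn' := stub_nfValue w' L c' μ' n' hw' hL3 hnd' hnf'
  have h1 : r.value = n.value := KZ.Equivalent.value_eq_holds hrn
  have h2 : r'.value = n'.value := KZ.Equivalent.value_eq_holds hrn'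
  have heq := hv
  rw [h1, h2, hvn, hvn'] at heq
  -- S5 (with S3, S4): compare coefficients
  obtain ⟨hcc, hsame, hdiff⟩ :=
    stub_rigidityNumbers stub_pairValueAlgebraic stub_okada w w' L c c' μ μ' hw hw' hL3 heq
  subst hcc
  by_cases hww : w = w'
  · -- equal weights: the two normal forms coincide on the box
    subst hww
    have hμ := hsame rfl
    have hnn' : KZ.Equivalent n n' := by
      refine KZ.of_sub_of_mem_relations_of_eqOn (by rw [hnd, hnd']) fun x hx => ?_
      have hx' : x ∈ n'.domain := by rw [hnd']; rw [hnd] at hx; exact hx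
      rw [hnf hx, hnf' hx']
      refine congrArg₂ (· + ·) rfl (Finset.sum_congr rfl fun a ha => ?_)
      rw [hμ a ha]
    exact (hrn.trans hnn').trans hrn'.symm
  · -- different weights: both normal forms are the constant `c`
    have hμ0 := hdiff hww
    have hnc : Set.EqOn n.integrand (fun _ => (c : ℝ)) n.domain := fun x hx => by
      rw [hnf hx]
      simp only
      rw [Finset.sum_eq_zero fun a ha => by rw [(hμ0 a ha).1]; push_cast; ring, add_zero]
    have hnc' : Set.EqOn n'.integrand (fun _ => (c : ℝ)) n'.domain := fun x hx => by
      rw [hnf' hx]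
      simp only
      rw [Finset.sum_eq_zero fun a ha => by rw [(hμ0 a ha).2]; push_cast; ring, add_zero]
    have hnn' : KZ.Equivalent n n' :=
      stub_constAcrossDim w w' c n n' (by omega) (by omega) hnd hnc hnd' hnc'
    exact (hrn.trans hnn').trans hrn'.symm

end Summit.KontsevichZagierPeriods.Theorems.HurwitzMicroSectorsHurwitzSectorComplement

end
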